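import Literature.Analysis.UnboundedOperators.LinearizedBoltzmannPositivityProofs
import Literature.Analysis.FluidPDE.CollisionWeakForm
import HarnessLib

/-!
# The linearised Boltzmann collision operator: symmetry on `L²(M dv)` (discharges)

Sibling proof file of `LinearizedBoltzmann.lean` (D-0014), next to `LinearizedBoltzmannProofs`,
`…PositivityProofs` (whose Gaussian moments `integrable_one_add_norm_pow_stdGaussian` are reused)
and `…IsotropyProofs`. It discharges

* `maxwellianInner_linearizedCollisionOp_comm_holds` — the symmetry `⟪h, L_B g⟫_M = ⟪L_B h, g⟫_M`
  of the linearised collision operator `L_B g = M⁻¹ (Q_B(M, M g) + Q_B(M g, M))` on functions of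
  temperate growth, for a measurable, polynomially bounded kernel `B` with the two
  micro-reversibility symmetries (Cercignani–Illner–Pulvirenti 1994 §7.1 (7.1.9));
* `maxwellianInner_hardSphereLinearizedOp_self_nonpos_holds` — non-positivity `⟪g, L g⟫_M ≤ 0` of
  the linearised hard-sphere operator (CIP 1994 §7.1 (7.1.10)), via the general Grad cut-off case
  `maxwellianInner_linearizedCollisionOp_self_nonpos`.

Source. C. Cercignani, R. Illner, M. Pulvirenti, *The Mathematical Theory of Dilute Gases*,
Springer (1994), §7.1 pp. 191–193: the explicit form (7.1.6) of `L`, the identity (7.1.7)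
`∫ g L h dξ = -¼ ∫∫∫ (h'R_*' + R'h_*' - hR_* - Rh_*)(g'R_*' + R'g_*' - gR_* - Rg_*) |V·n| dξ dξ_* dn`
("because of Eq. (3.1.10)", the weak formulation), and its consequences (7.1.9)
`(g, Lh) = (Lg, h)` ("thanks to the symmetry of the right-hand side of (1.7) with respect to the
interchange `g ⇔ h`") and (7.1.10) `(h, Lh) ≤ 0`. CIP write `f = M + M^{1/2} h` in the flat
`L²(dξ)`; the statement file uses the unitarily equivalent weighted picture `F = M(1 + g)`,
`L²(M dv)` (`maxwellianInner`, `M dv = stdGaussian E`), in which `R = M^{1/2}` disappears and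
(7.1.7) reads `⟪h, L_B g⟫_M = -¼ ∫∫∫ M M_* B (h' + h_*' - h - h_*)(g' + g_*' - g - g_*) dω dv_* dv`
(`maxwellianInner_linearizedCollisionOp_eq`).

Proof (as printed, for a general micro-reversible kernel). Write `stdGaussian E = M dv`
(`Literature.Analysis.FluidPDE.stdGaussian_eq_withDensity_globalMaxwellian_holds`) and pass to
`dv dv_* dω` on `E × E × S^{d-1}` by Fubini (`K = M M_* B (g' + g_*' - g - g_*) h(v)` is dominated
by `C ρ(v) ρ(v_*)`, `ρ(u) = (1 + |u|)^N M(u) ∈ L¹`: polynomial bounds on `B, g, h`,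
`|v'|, |v_*'| ≤ |v| + |v_*|`, Gaussian moments). The density
`D = M M_* B (g' + g_*' - g - g_*)` is even under `T₂ : (v, v_*, ω) ↦ (v_*, v, -ω)` and odd under
`T₁ : (v, v_*, ω) ↦ (v_*', v', ω)` (`M'M_*' = M M_*`), which preserve `dv dv_* dω`
(`Literature.Analysis.FluidPDE.integral_comp_swap_negDir`, `…integral_comp_collideSwap_prod`;
CIP 1994 §3.1 p. 35); averaging `∫ K` over `{id, T₂, T₁, T₁T₂}` gives (7.1.7), symmetric in
`g ⇔ h`; for `h = g` and `B ≥ 0` its right-hand side is `≤ 0`.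
-/

open MeasureTheory Metric Real Set Filter Topology ProbabilityTheory
open scoped InnerProductSpace ENNReal

namespace Literature.Analysis.UnboundedOperators

noncomputable section

open Literature.MathematicalPhysics.KineticTheory (collide sphereMeasure hardSphereKernel
  norm_sq_collide_fst_add_norm_sq_collide_snd)
open Literature.Analysis.FluidPDE

/-! ## Elementary bounds -/

section Bounds

variable {E : Type*} [NormedAddCommGroup E]

/-- `1 + ‖(v, v_*)‖ ≤ (1 + ‖v‖)(1 + ‖v_*‖)` for the sup norm on `E × E`. [folklore] -/
theorem one_add_norm_prod_le (p : E × E) : 1 + ‖p‖ ≤ (1 + ‖p.1‖) * (1 + ‖p.2‖) := by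
  have h := max_le_add_of_nonneg (norm_nonneg p.1) (norm_nonneg p.2)
  rw [Prod.norm_def]
  nlinarith [mul_nonneg (norm_nonneg p.1) (norm_nonneg p.2)]

/-- `1 + ‖v‖ ≤ (1 + ‖v‖)(1 + ‖v_*‖)`. [folklore] -/
theorem one_add_norm_fst_le (p : E × E) : 1 + ‖p.1‖ ≤ (1 + ‖p.1‖) * (1 + ‖p.2‖) :=
  le_mul_of_one_le_right (by positivity) (by linarith [norm_nonneg p.2])
/-- `1 + ‖v_*‖ ≤ (1 + ‖v‖)(1 + ‖v_*‖)`. [folklore] -/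
theorem one_add_norm_snd_le (p : E × E) : 1 + ‖p.2‖ ≤ (1 + ‖p.1‖) * (1 + ‖p.2‖) :=
  le_mul_of_one_le_left (by positivity) (by linarith [norm_nonneg p.1])

variable [InnerProductSpace ℝ E]

/-- `1 + ‖v'‖ ≤ (1 + ‖v‖)(1 + ‖v_*‖)` (conservation of energy). [folklore] -/
theorem one_add_norm_collide_fst_le (ω : sphere (0 : E) 1) (p : E × E) :
    1 + ‖(collide ω p).1‖ ≤ (1 + ‖p.1‖) * (1 + ‖p.2‖) := by
  have h := norm_collide_fst_le ω p
  nlinarith [norm_nonneg p.1, norm_nonneg p.2]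
/-- `1 + ‖v_*'‖ ≤ (1 + ‖v‖)(1 + ‖v_*‖)` (conservation of energy). [folklore] -/
theorem one_add_norm_collide_snd_le (ω : sphere (0 : E) 1) (p : E × E) :
    1 + ‖(collide ω p).2‖ ≤ (1 + ‖p.1‖) * (1 + ‖p.2‖) := by
  have h := norm_collide_snd_le ω p
  nlinarith [norm_nonneg p.1, norm_nonneg p.2]

/-- The Maxwellian weight `M ⊗ M` is a collision invariant:
`M(v_*') M(v') = M(v) M(v_*)` (conservation of kinetic energy; CIP 1994 §7.1, "we took into
account that `M'M_*' = M M_*`"; stated in the order produced by the swapped collision map).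
[cite: CIPDiluteGases1994, §7.1 (7.1.6)] -/
theorem globalMaxwellian_collide_snd_mul_fst (ω : sphere (0 : E) 1) (p : E × E) :
    globalMaxwellian (collide ω p).2 * globalMaxwellian (collide ω p).1 =
      globalMaxwellian p.1 * globalMaxwellian p.2 := by
  have h := norm_sq_collide_fst_add_norm_sq_collide_snd ω p
  simp only [globalMaxwellian]
  rw [mul_mul_mul_comm, ← Real.exp_add, mul_mul_mul_comm, ← Real.exp_add]
  congr 2
  linear_combination (-(1 : ℝ) / 2) * h

/-- A function of temperate growth is polynomially bounded: `|f x| ≤ C (1 + ‖x‖)^k`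
(order `0` of `Function.HasTemperateGrowth`). [folklore] -/
theorem exists_abs_le_of_hasTemperateGrowth {f : E → ℝ} (hf : f.HasTemperateGrowth) :
    ∃ (k : ℕ) (C : ℝ), 0 ≤ C ∧ ∀ x, |f x| ≤ C * (1 + ‖x‖) ^ k := by
  obtain ⟨k, C, hC, h⟩ := hf.norm_iteratedFDeriv_le_uniform 0
  exact ⟨k, C, hC, fun x => by simpa [norm_iteratedFDeriv_zero] using h 0 le_rfl x⟩

/-- The weight bound `|(g' + g_*' - g - g_*) h(u)| ≤ 4 C_g C_h ((1 + ‖v‖)(1 + ‖v_*‖))^{a+b}` for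
`|g| ≤ C_g (1 + ‖·‖)^a`, `|h| ≤ C_h (1 + ‖·‖)^b`, `1 + ‖u‖ ≤ (1 + ‖v‖)(1 + ‖v_*‖)`. [folklore] -/
theorem abs_collisionDiff_mul_le {g h : E → ℝ} {C_g C_h : ℝ} {a b : ℕ} (hCg : 0 ≤ C_g)
    (hCh : 0 ≤ C_h) (hga : ∀ u, |g u| ≤ C_g * (1 + ‖u‖) ^ a)
    (hhb : ∀ u, |h u| ≤ C_h * (1 + ‖u‖) ^ b) (p : E × E) (ω : sphere (0 : E) 1) {u : E}
    (hu : 1 + ‖u‖ ≤ (1 + ‖p.1‖) * (1 + ‖p.2‖)) :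
    |(g (collide ω p).1 + g (collide ω p).2 - g p.1 - g p.2) * h u| ≤
      4 * C_g * C_h * ((1 + ‖p.1‖) * (1 + ‖p.2‖)) ^ (a + b) := by
  set X : ℝ := (1 + ‖p.1‖) * (1 + ‖p.2‖) with hX
  have hgX : ∀ u : E, 1 + ‖u‖ ≤ X → |g u| ≤ C_g * X ^ a := fun u hu =>
    (hga u).trans (mul_le_mul_of_nonneg_left (pow_le_pow_left₀ (by positivity) hu a) hCg)
  have h1 := hgX _ (one_add_norm_collide_fst_le ω p)
  have h2 := hgX _ (one_add_norm_collide_snd_le ω p)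
  have h3 := hgX _ (one_add_norm_fst_le p)
  have h4 := hgX _ (one_add_norm_snd_le p)
  have hhX : |h u| ≤ C_h * X ^ b :=
    (hhb u).trans (mul_le_mul_of_nonneg_left (pow_le_pow_left₀ (by positivity) hu b) hCh)
  have hG : |g (collide ω p).1 + g (collide ω p).2 - g p.1 - g p.2| ≤ 4 * (C_g * X ^ a) :=
    calc |g (collide ω p).1 + g (collide ω p).2 - g p.1 - g p.2|
        ≤ |g (collide ω p).1 + g (collide ω p).2 - g p.1| + |g p.2| := abs_sub _ _
      _ ≤ |g (collide ω p).1 + g (collide ω p).2| + |g p.1| + |g p.2| := by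
          gcongr; exact abs_sub _ _
      _ ≤ |g (collide ω p).1| + |g (collide ω p).2| + |g p.1| + |g p.2| := by
          gcongr; exact abs_add_le _ _
      _ ≤ 4 * (C_g * X ^ a) := by linarith
  rw [abs_mul, pow_add]
  calc |g (collide ω p).1 + g (collide ω p).2 - g p.1 - g p.2| * |h u|
      ≤ 4 * (C_g * X ^ a) * (C_h * X ^ b) := mul_le_mul hG hhX (abs_nonneg _) (by positivity)
    _ = 4 * C_g * C_h * (X ^ a * X ^ b) := by ring

end Bounds

/-! ## Integrability of the Maxwellian-weighted integrands -/

section Integrability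

variable {E : Type*} [NormedAddCommGroup E] [InnerProductSpace ℝ E] [FiniteDimensional ℝ E]
  [MeasurableSpace E] [BorelSpace E]

/-- Polynomially weighted Maxwellians are Lebesgue integrable:
`(1 + ‖v‖)^n M(v) ∈ L¹(dv)` (`stdGaussian E = M dv` and the Gaussian moments
`integrable_one_add_norm_pow_stdGaussian` of `LinearizedBoltzmannPositivityProofs`). [folklore] -/
theorem integrable_one_add_norm_pow_mul_globalMaxwellian (n : ℕ) :
    Integrable (fun u : E => (1 + ‖u‖) ^ n * globalMaxwellian u) := by
  have h := integrable_one_add_norm_pow_stdGaussian (E := E) n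
  rw [stdGaussian_eq_withDensity_globalMaxwellian_holds,
    integrable_withDensity_iff_integrable_smul'
      continuous_globalMaxwellian.measurable.ennreal_ofReal
      (Eventually.of_forall fun _ => ENNReal.ofReal_lt_top)] at h
  refine h.congr (Eventually.of_forall fun u => ?_)
  simp only [ENNReal.toReal_ofReal (globalMaxwellian_pos u).le, smul_eq_mul]
  ring

variable {B : E × E → sphere (0 : E) 1 → ℝ}

/-- **Domination of the Maxwellian-weighted integrands.** For a measurable kernel of polynomial
growth `|B| ≤ C_B (1 + ‖(v, v_*)‖)^k` and a measurable weight
`|W| ≤ C_W ((1 + ‖v‖)(1 + ‖v_*‖))^m`, the integrand `M(v) M(v_*) B W` is integrable on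
`E × E × S^{d-1}` (dominated by `|C_B| |C_W| ρ(v) ρ(v_*)`, `ρ(u) = (1 + ‖u‖)^{k+m} M(u) ∈ L¹`).
[folklore] -/
theorem integrable_maxwellian_kernel_mul (hBm : Measurable (Function.uncurry B)) {C_B : ℝ}
    {k : ℕ} (hBle : ∀ p ω, |B p ω| ≤ C_B * (1 + ‖p‖) ^ k)
    {W : (E × E) × sphere (0 : E) 1 → ℝ}
    (hWm : AEStronglyMeasurable W (((volume : Measure E).prod volume).prod sphereMeasure))
    {C_W : ℝ} {m : ℕ} (hW : ∀ q, |W q| ≤ C_W * ((1 + ‖q.1.1‖) * (1 + ‖q.1.2‖)) ^ m) :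
    Integrable (fun q : (E × E) × sphere (0 : E) 1 =>
        globalMaxwellian q.1.1 * globalMaxwellian q.1.2 * B q.1 q.2 * W q)
      (((volume : Measure E).prod volume).prod sphereMeasure) := by
  haveI := isFiniteMeasure_sphereMeasure (E := E)
  set ρ : E → ℝ := fun u => (1 + ‖u‖) ^ (k + m) * globalMaxwellian u with hρ
  have hρi : Integrable ρ := integrable_one_add_norm_pow_mul_globalMaxwellian (k + m)
  have hdom : Integrable (fun q : (E × E) × sphere (0 : E) 1 =>
      |C_B| * |C_W| * (ρ q.1.1 * ρ q.1.2))
      (((volume : Measure E).prod volume).prod sphereMeasure) :=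
    ((hρi.mul_prod hρi).comp_fst sphereMeasure).const_mul _
  refine hdom.mono' ?_ (Eventually.of_forall fun q => ?_)
  · have hM : Continuous fun q : (E × E) × sphere (0 : E) 1 =>
        globalMaxwellian q.1.1 * globalMaxwellian q.1.2 := by fun_prop
    exact (hM.aestronglyMeasurable.mul hBm.aestronglyMeasurable).mul hWm
  obtain ⟨⟨v, w⟩, ω⟩ := q
  rw [Real.norm_eq_abs, abs_mul, abs_mul, abs_mul, abs_of_pos (globalMaxwellian_pos v),
    abs_of_pos (globalMaxwellian_pos w)]
  dsimp only
  set X : ℝ := (1 + ‖v‖) * (1 + ‖w‖) with hX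
  have hM0 := (mul_pos (globalMaxwellian_pos v) (globalMaxwellian_pos w)).le
  have hBX : |B (v, w) ω| ≤ |C_B| * X ^ k := by
    refine (hBle (v, w) ω).trans ?_
    refine (mul_le_mul_of_nonneg_right (le_abs_self C_B) (by positivity)).trans ?_
    exact mul_le_mul_of_nonneg_left
      (pow_le_pow_left₀ (by positivity) (one_add_norm_prod_le (v, w)) k) (abs_nonneg _)
  have hWX : |W ((v, w), ω)| ≤ |C_W| * X ^ m :=
    (hW ((v, w), ω)).trans (mul_le_mul_of_nonneg_right (le_abs_self _) (by positivity))
  calc globalMaxwellian v * globalMaxwellian w * |B (v, w) ω| * |W ((v, w), ω)|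
      ≤ globalMaxwellian v * globalMaxwellian w * (|C_B| * X ^ k) * (|C_W| * X ^ m) :=
        mul_le_mul (mul_le_mul_of_nonneg_left hBX hM0) hWX (abs_nonneg _)
          (mul_nonneg hM0 (by positivity))
    _ = |C_B| * |C_W| * (ρ v * ρ w) := by
        simp only [hρ, hX, pow_add, mul_pow]; ring

end Integrability

/-! ## The symmetrised form (CIP 1994 (7.1.7)) and its consequences -/

section Symmetry

variable {E : Type*} [NormedAddCommGroup E] [InnerProductSpace ℝ E] [FiniteDimensional ℝ E]
  [MeasurableSpace E] [BorelSpace E]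

/-- **The symmetrised form of `⟪h, L_B g⟫_M`** (CIP 1994 §7.1 (7.1.7), from the weak formulation
(3.1.10)): for a measurable, polynomially bounded kernel `B` with the micro-reversibility
symmetries `B(v', v_*', -ω) = B(v, v_*, ω)`, `B(v_*, v, -ω) = B(v, v_*, ω)` and `g, h` of temperate
growth,
`⟪h, L_B g⟫_M = -¼ ∫∫∫ M(v) M(v_*) B (h' + h_*' - h - h_*)(g' + g_*' - g - g_*) dω dv_* dv`.
[cite: CIPDiluteGases1994, §7.1 (7.1.7)] -/
theorem maxwellianInner_linearizedCollisionOp_eq {B : E × E → sphere (0 : E) 1 → ℝ}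
    (hBm : Measurable (Function.uncurry B))
    (hB : ∃ (k : ℕ) (C : ℝ), ∀ p ω, |B p ω| ≤ C * (1 + ‖p‖) ^ k)
    (hcoll : ∀ ω p, B (collide ω p) (-ω) = B p ω) (hswap : ∀ ω p, B p.swap (-ω) = B p ω)
    {g h : E → ℝ} (hg : g.HasTemperateGrowth) (hh : h.HasTemperateGrowth) :
    maxwellianInner h (linearizedCollisionOp B g) =
      -4⁻¹ * ∫ q : (E × E) × sphere (0 : E) 1,
        globalMaxwellian q.1.1 * globalMaxwellian q.1.2 * B q.1 q.2 *
          ((h (collide q.2 q.1).1 + h (collide q.2 q.1).2 - h q.1.1 - h q.1.2) *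
            (g (collide q.2 q.1).1 + g (collide q.2 q.1).2 - g q.1.1 - g q.1.2))
        ∂(((volume : Measure E).prod volume).prod sphereMeasure) := by
  haveI := isFiniteMeasure_sphereMeasure (E := E)
  have hBc : ∀ p ω, B (collide ω p) (-ω) = B p ω := fun p ω => hcoll ω p
  have hBs : ∀ p ω, B p.swap (-ω) = B p ω := fun p ω => hswap ω p
  obtain ⟨k, C_B, hBle⟩ := hB
  obtain ⟨a, C_g, hCg, hga⟩ := exists_abs_le_of_hasTemperateGrowth hg
  obtain ⟨b, C_h, hCh, hhb⟩ := exists_abs_le_of_hasTemperateGrowth hh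
  have hgc : Continuous g := hg.1.continuous
  have hhc : Continuous h := hh.1.continuous
  set μ : Measure ((E × E) × sphere (0 : E) 1) :=
    ((volume : Measure E).prod volume).prod sphereMeasure
  -- the density `D = M M_* B (g' + g_*' - g - g_*)` and the four weighted integrands
  set D : (E × E) × sphere (0 : E) 1 → ℝ := fun q =>
    globalMaxwellian q.1.1 * globalMaxwellian q.1.2 * B q.1 q.2 *
      (g (collide q.2 q.1).1 + g (collide q.2 q.1).2 - g q.1.1 - g q.1.2) with hD
  set K₁ : (E × E) × sphere (0 : E) 1 → ℝ := fun q => D q * h q.1.1 with hK₁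
  set K₂ : (E × E) × sphere (0 : E) 1 → ℝ := fun q => D q * h q.1.2 with hK₂
  set K₃ : (E × E) × sphere (0 : E) 1 → ℝ := fun q => D q * h (collide q.2 q.1).1 with hK₃
  set K₄ : (E × E) × sphere (0 : E) 1 → ℝ := fun q => D q * h (collide q.2 q.1).2 with hK₄
  -- integrability of `K₁`
  have hK₁i : Integrable K₁ μ := by
    have hWc : Continuous fun q : (E × E) × sphere (0 : E) 1 =>
        (g (collide q.2 q.1).1 + g (collide q.2 q.1).2 - g q.1.1 - g q.1.2) * h q.1.1 := by
      fun_prop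
    have := integrable_maxwellian_kernel_mul hBm hBle hWc.aestronglyMeasurable fun q =>
      abs_collisionDiff_mul_le hCg hCh hga hhb q.1 q.2 (one_add_norm_fst_le q.1)
    refine this.congr (Eventually.of_forall fun q => ?_)
    simp only [hK₁, hD]
    ring
  -- behaviour of `D` under the two involutions
  have hD₂ : ∀ q : (E × E) × sphere (0 : E) 1, D (q.1.swap, -q.2) = D q := by
    intro q
    simp only [hD, collide_neg_dir, collide_swap, Prod.fst_swap, Prod.snd_swap, hBs]
    ring
  have hD₁ : ∀ q : (E × E) × sphere (0 : E) 1, D ((collide q.2 q.1).swap, q.2) = -D q := by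
    intro q
    simp only [hD, collide_collideSwap, Prod.fst_swap, Prod.snd_swap, kernel_collideSwap hBc hBs,
      globalMaxwellian_collide_snd_mul_fst]
    ring
  -- `K₁ ∘ T₂ = K₂`, `K₁ ∘ T₁ = -K₄`, `K₄ ∘ T₂ = K₃`
  have hK₁₂ : ∀ q : (E × E) × sphere (0 : E) 1, K₁ (q.1.swap, -q.2) = K₂ q := by
    intro q; simp only [hK₁, hK₂, hD₂, Prod.fst_swap]
  have hK₁₄ : ∀ q : (E × E) × sphere (0 : E) 1, K₁ ((collide q.2 q.1).swap, q.2) = -K₄ q := by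
    intro q; simp only [hK₁, hK₄, hD₁, Prod.fst_swap, neg_mul]
  have hK₄₃ : ∀ q : (E × E) × sphere (0 : E) 1, K₄ (q.1.swap, -q.2) = K₃ q := by
    intro q; simp only [hK₄, hK₃, hD₂, collide_neg_dir, collide_swap, Prod.snd_swap]
  -- integrability of `K₂, K₃, K₄`
  have hK₂i : Integrable K₂ μ :=
    ((integrable_comp_swap_negDir_iff K₁).2 hK₁i).congr (Eventually.of_forall hK₁₂)
  have hK₄i : Integrable K₄ μ := ((integrable_comp_collideSwap_prod_iff K₁).2 hK₁i).neg.congr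
    (Eventually.of_forall fun q => by simp only [Pi.neg_apply, hK₁₄, neg_neg])
  have hK₃i : Integrable K₃ μ :=
    ((integrable_comp_swap_negDir_iff K₄).2 hK₄i).congr (Eventually.of_forall hK₄₃)
  -- the integrals of `K₂, K₃, K₄` in terms of `∫ K₁`
  have hI₂ : ∫ q, K₂ q ∂μ = ∫ q, K₁ q ∂μ := by
    rw [← integral_comp_swap_negDir K₁]
    exact integral_congr_ae (Eventually.of_forall fun q => (hK₁₂ q).symm)
  have hI₄ : ∫ q, K₄ q ∂μ = -∫ q, K₁ q ∂μ := by
    rw [← integral_comp_collideSwap_prod K₁, ← integral_neg]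
    exact integral_congr_ae (Eventually.of_forall fun q => by simp only [hK₁₄, neg_neg])
  have hI₃ : ∫ q, K₃ q ∂μ = ∫ q, K₄ q ∂μ := by
    rw [← integral_comp_swap_negDir K₄]
    exact integral_congr_ae (Eventually.of_forall fun q => (hK₄₃ q).symm)
  -- Step 1: `⟪h, L_B g⟫_M = ∫ K₁` (density bridge `stdGaussian E = M dv` twice, then Fubini)
  have hLHS : maxwellianInner h (linearizedCollisionOp B g) = ∫ q, K₁ q ∂μ := by
    have h1 : maxwellianInner h (linearizedCollisionOp B g) =
        ∫ v, ∫ w, ∫ ω, K₁ ((v, w), ω) ∂sphereMeasure := by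
      simp only [maxwellianInner, linearizedCollisionOp,
        integral_stdGaussian_eq_integral_mul_globalMaxwellian]
      refine integral_congr_ae (Eventually.of_forall fun v => ?_)
      dsimp only
      rw [← mul_assoc, ← integral_const_mul]
      refine integral_congr_ae (Eventually.of_forall fun w => ?_)
      dsimp only
      rw [← mul_assoc, ← integral_const_mul]
      refine integral_congr_ae (Eventually.of_forall fun ω => ?_)
      simp only [hK₁, hD]
      ring
    have h2 : ∫ v, ∫ w, ∫ ω, K₁ ((v, w), ω) ∂sphereMeasure =
        ∫ p, ∫ ω, K₁ (p, ω) ∂sphereMeasure ∂((volume : Measure E).prod volume) :=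
      (integral_prod (fun p : E × E => ∫ ω, K₁ (p, ω) ∂sphereMeasure)
        hK₁i.integral_prod_left).symm
    rw [h1, h2, ← integral_prod _ hK₁i]
  -- Step 2: symmetrise over `{id, T₂, T₁, T₁ T₂}`
  have hsum : ∫ q, (K₁ q + K₂ q - K₃ q - K₄ q) ∂μ = 4 * ∫ q, K₁ q ∂μ := by
    rw [integral_sub (f := fun q => K₁ q + K₂ q - K₃ q) ((hK₁i.add hK₂i).sub hK₃i) hK₄i,
      integral_sub (f := fun q => K₁ q + K₂ q) (hK₁i.add hK₂i) hK₃i, integral_add hK₁i hK₂i,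
      hI₂, hI₃, hI₄]
    ring
  rw [hLHS]
  have hpt : (fun q : (E × E) × sphere (0 : E) 1 =>
      globalMaxwellian q.1.1 * globalMaxwellian q.1.2 * B q.1 q.2 *
        ((h (collide q.2 q.1).1 + h (collide q.2 q.1).2 - h q.1.1 - h q.1.2) *
          (g (collide q.2 q.1).1 + g (collide q.2 q.1).2 - g q.1.1 - g q.1.2))) =
      fun q => -(K₁ q + K₂ q - K₃ q - K₄ q) := by
    funext q; simp only [hK₁, hK₂, hK₃, hK₄, hD]; ring
  rw [hpt, integral_neg, hsum]
  ring

/-- **Discharge of `maxwellianInner_linearizedCollisionOp_comm`** (symmetry of the linearised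
collision operator, CIP 1994 §7.1 (7.1.9) `(g, Lh) = (Lg, h)`; Ellis–Pinsky 1975 §1): both sides
equal the symmetrised form (7.1.7), which is symmetric under `g ⇔ h`.
[cite: CIPDiluteGases1994, §7.1 (7.1.9)] -/
theorem maxwellianInner_linearizedCollisionOp_comm_holds :
    maxwellianInner_linearizedCollisionOp_comm (E := E) := by
  intro B hBm hB hcoll hswap g h hg hh
  have hsymm : maxwellianInner (linearizedCollisionOp B h) g =
      maxwellianInner g (linearizedCollisionOp B h) := by
    simp only [maxwellianInner, mul_comm]
  rw [hsymm, maxwellianInner_linearizedCollisionOp_eq hBm hB hcoll hswap hg hh,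
    maxwellianInner_linearizedCollisionOp_eq hBm hB hcoll hswap hh hg]
  congr 1
  refine integral_congr_ae (Eventually.of_forall fun q => ?_)
  dsimp only
  ring

/-- Non-positivity of the linearised collision operator of a **Grad cut-off kernel**
(`IsGradCutoffKernel`: measurable, `0 ≤ B ≤ C (1 + |v - v_*|)`, micro-reversible), in particular
of the hard-sphere kernel: `⟪g, L_B g⟫_M = -¼ ∫∫∫ M M_* B (g' + g_*' - g - g_*)² ≤ 0` for `g` of
temperate growth (CIP 1994 §7.1 (7.1.10)). [cite: CIPDiluteGases1994, §7.1 (7.1.10)] -/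
theorem maxwellianInner_linearizedCollisionOp_self_nonpos {B : E × E → sphere (0 : E) 1 → ℝ}
    (hB : IsGradCutoffKernel B) {g : E → ℝ} (hg : g.HasTemperateGrowth) :
    maxwellianInner g (linearizedCollisionOp B g) ≤ 0 := by
  obtain ⟨C, hC⟩ := hB.exists_bound
  have hBle : ∀ p ω, |B p ω| ≤ 2 * |C| * (1 + ‖p‖) ^ 1 := fun p ω => by
    have h1 : ‖p.1 - p.2‖ ≤ ‖p‖ + ‖p‖ :=
      (norm_sub_le _ _).trans (add_le_add (norm_fst_le p) (norm_snd_le p))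
    rw [abs_of_nonneg (hB.nonneg p ω), pow_one]
    nlinarith [hC p ω, le_abs_self C, abs_nonneg C, norm_nonneg (p.1 - p.2), norm_nonneg p]
  rw [maxwellianInner_linearizedCollisionOp_eq hB.measurable ⟨1, 2 * |C|, hBle⟩
    (fun ω p => hB.collide_neg p ω) (fun ω p => hB.swap_neg p ω) hg hg, neg_mul, neg_nonpos]
  refine mul_nonneg (by norm_num) (integral_nonneg fun q => ?_)
  exact mul_nonneg (mul_nonneg (mul_nonneg (globalMaxwellian_pos _).le
    (globalMaxwellian_pos _).le) (hB.nonneg _ _)) (mul_self_nonneg _)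

/-- **Discharge of `maxwellianInner_hardSphereLinearizedOp_self_nonpos`** (non-positivity of the
linearised hard-sphere operator, CIP 1994 §7.1 (7.1.10) `(h, Lh) ≤ 0`; Ellis–Pinsky 1975 §1): the
hard-sphere kernel is a Grad cut-off kernel (`isGradCutoffKernel_hardSphereKernel`).
[cite: CIPDiluteGases1994, §7.1 (7.1.10)] -/
theorem maxwellianInner_hardSphereLinearizedOp_self_nonpos_holds :
    maxwellianInner_hardSphereLinearizedOp_self_nonpos (E := E) :=
  fun hg => maxwellianInner_linearizedCollisionOp_self_nonpos isGradCutoffKernel_hardSphereKernel hg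

end Symmetry

end

end Literature.Analysis.UnboundedOperators
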